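import Summits.MatrixMultiplication.MatrixMultiplication.Theorems.ObstructionDescentCornerOddLevel

set_option linter.dupNamespace false

/-!
# Obstruction descent, part U — descent law: a level empty one format down lies in `I(σ_r)`, `(k−1)r < kN`;
# Strassen's range `r₃(3) ≥ 5` in kernel

`route-MatrixMultiplication-ObstructionDescent`, aside `InvariantSaturation` (stmt 32282); decomp-mm lens-3, NODE-g15.

The CUBE LAW (part I, `evalT_eq_zero_of_unitWindow`) needs a DEAD UNIT WINDOW: `f(y⁰ + e_{abc}) = 0` for all `y⁰` off the
slices through the cell.  This file discharges that hypothesis STRUCTURALLY: the unit-window function `y ↦ f(y|_{B³} + e₀₀₀)`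
(`B` = the last `N−1` indices) is the block restriction `restrictB (N−1) e₀₀₀ f` of gen 14 (H13, `restrictB_mem_hwvSpace`), a
level-`k` vector of block format `N−1`; so if level `k` is EMPTY AT FORMAT `N−1` the window is dead and the cube law fires:

* `evalT_eq_zero_of_emptyLevel_pred` — `k ∈ emptyLevels (N−1) (N−1)`, `f ∈ hwvSpace (rectType N N k) (kN)`,
  `(k−1)·r < k·N`, `R(t) ≤ r` ⇒ `f(t) = 0` (the DESCENT LAW; compare the pair law of parts K–P: empty at format `2` ⇒
  `(k−1)(r−1) < k(N−1)`);
* corner form at every ambient format `m ≥ N` (`evalT_eq_zero_of_emptyLevel_pred_corner`, part L lift);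
* **Strassen's range in kernel** (`N = 3`, `k = 3`, `3 ∈ emptyLevels 2 2` by part N): EVERY level-`3` vector of block format
  `3` (degree `9`; classically the line spanned by Strassen's invariant) vanishes on all tensors of rank `≤ 4`
  (`evalT_eq_zero_of_level_three_three`, `…_corner`), i.e. `F(t) ≠ 0 ⇒ R(t) ≥ 5` (`five_le_tensorRank_of_level_three_three`)
  — the sharp value `r₃(3) = 5` on the lower side, one better than the pair law — and level `3` of block format `3` is dead
  on `GL_m³·⟨m⟩` for `m = 3, 4` (`three_not_mem_passLevels_three`).

[cite: BurgisserIkenmeyer2011, §3.1–3.2 and §6.2], [cite: BurgisserIkenmeyer2017, §5 (5.2), Thm 5.3],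
[cite: LandsbergGCT2017, §8.3.4].
-/

noncomputable section

open scoped BigOperators
open Finset

namespace Summit.MatrixMultiplication.MatrixMultiplication.Theorems.ObstructionCalculus

open Literature.Computability.AlgebraicComplexity (actTensor actTensor_apply unitTensor triad triad_apply tensorRank
  tensorRestrictsTo_actTensor TensorRestrictsTo)

section DescentLaw

/-- The unit tensor `e₀₀₀` is block-diagonal for the last-`m'` block of format `m' + 1`. [bookkeeping] -/
theorem triad_single_zero_mem_blockDiag (m' : ℕ) :
    (triad (Pi.single (0 : Fin (m' + 1)) (1 : ℂ)) (Pi.single 0 1) (Pi.single 0 1) : Tensor ℂ (m' + 1)) ∈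
      blockDiag (m' + 1) m' := by
  intro a b c hne
  rw [triad_single_apply] at hne
  split_ifs at hne with h
  · simp only [Prod.mk.injEq] at h
    obtain ⟨rfl, rfl, rfl⟩ := h
    right
    simp
  · exact absurd rfl hne

/-- The unit-window point at the cell `(0,0,0)` is the block mixture of `e₀₀₀` with `y`. [bookkeeping] -/
theorem mixT_triad_single_zero (m' : ℕ) (y : Tensor ℂ (m' + 1)) :
    mixT m' (triad (Pi.single (0 : Fin (m' + 1)) (1 : ℂ)) (Pi.single 0 1) (Pi.single 0 1)) y =
      (fun a b c => if a = 0 ∨ b = 0 ∨ c = 0 then 0 else y a b c) +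
        triad (Pi.single (0 : Fin (m' + 1)) (1 : ℂ)) (Pi.single 0 1) (Pi.single 0 1) := by
  funext a b c
  have ha : (m' + 1 ≤ (a : ℕ) + m') ↔ a ≠ 0 := by rw [Ne, Fin.ext_iff, Fin.val_zero]; omega
  have hb : (m' + 1 ≤ (b : ℕ) + m') ↔ b ≠ 0 := by rw [Ne, Fin.ext_iff, Fin.val_zero]; omega
  have hc : (m' + 1 ≤ (c : ℕ) + m') ↔ c ≠ 0 := by rw [Ne, Fin.ext_iff, Fin.val_zero]; omega
  simp only [mixT, Pi.add_apply, triad_single_apply, Prod.mk.injEq, ha, hb, hc]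
  by_cases h0 : a = 0 <;> by_cases h1 : b = 0 <;> by_cases h2 : c = 0 <;> simp [h0, h1, h2]

/-- **The unit window is dead when the level is empty one format down.**  For `k ∈ emptyLevels m' m'` and
`f ∈ hwvSpace (rectType (m'+1) (m'+1) k) (k(m'+1))`: `f(y⁰ + e₀₀₀) = 0` for every `y⁰` off the slices through `0`.
[this node] -/
theorem evalT_unitWindow_eq_zero_of_emptyLevel_pred {m' k : ℕ} (hk : k ∈ emptyLevels m' m')
    {f : MvPolynomial (Idx (m' + 1)) ℂ} (hf : f ∈ hwvSpace (rectType (m' + 1) (m' + 1) k) (k * (m' + 1)))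
    (y : Tensor ℂ (m' + 1)) :
    evalT ((fun a b c => if a = 0 ∨ b = 0 ∨ c = 0 then 0 else y a b c) +
      triad (Pi.single (0 : Fin (m' + 1)) (1 : ℂ)) (Pi.single 0 1) (Pi.single 0 1)) f = 0 := by
  have hg : restrictB m' (triad (Pi.single (0 : Fin (m' + 1)) (1 : ℂ)) (Pi.single 0 1) (Pi.single 0 1)) f ∈
      hwvSpace (rectType (m' + 1) m' k) (k * m') :=
    restrictB_mem_hwvSpace (Nat.le_succ m') (Nat.le_succ m') (triad_single_zero_mem_blockDiag m') hf
  have hbot : hwvSpace (rectType (m' + 1) m' k) (k * m') = ⊥ :=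
    (mem_emptyLevels_iff_self (Nat.le_succ m')).mpr hk
  rw [hbot, Submodule.mem_bot] at hg
  rw [← mixT_triad_single_zero, ← evalT_restrictB, hg, map_zero]

/-- **DESCENT LAW.**  If level `k` is empty at format `m'`, every level-`k` vector of the full format `m' + 1` vanishes on all
tensors of rank `≤ r` with `(k−1)·r < k·(m'+1)`. [this node] -/
theorem evalT_eq_zero_of_emptyLevel_pred {m' k : ℕ} (hk : k ∈ emptyLevels m' m')
    {f : MvPolynomial (Idx (m' + 1)) ℂ} (hf : f ∈ hwvSpace (rectType (m' + 1) (m' + 1) k) (k * (m' + 1)))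
    {r : ℕ} (hr : (k - 1) * r < k * (m' + 1)) {t : Tensor ℂ (m' + 1)} (ht : tensorRank t ≤ r) : evalT t f = 0 :=
  evalT_eq_zero_of_unitWindow hf (a := 0) (b := 0) (c := 0)
    (fun y => evalT_unitWindow_eq_zero_of_emptyLevel_pred hk hf y) hr ht

/-- **Descent law, corner form** at every ambient format `m ≥ m' + 1`. [this node] -/
theorem evalT_eq_zero_of_emptyLevel_pred_corner {m m' k : ℕ} (hk : k ∈ emptyLevels m' m') (hNm : m' + 1 ≤ m)
    {F : MvPolynomial (Idx m) ℂ} (hF : F ∈ hwvSpace (rectType m (m' + 1) k) (k * (m' + 1)))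
    {r : ℕ} (hr : (k - 1) * r < k * (m' + 1)) {t : Tensor ℂ m} (ht : tensorRank t ≤ r) : evalT t F = 0 := by
  obtain ⟨d, rfl⟩ : ∃ d, m = d + (m' + 1) := ⟨m - (m' + 1), by omega⟩
  obtain ⟨f, hf, rfl⟩ := exists_eq_liftPoly_of_mem_hwvSpace le_rfl hF
  rw [evalT_liftPoly]
  exact evalT_eq_zero_of_emptyLevel_pred hk hf hr ((tensorRank_cornerOf_le d t).trans ht)

end DescentLaw

section StrassenRange

/-- **Strassen's range in kernel:** every level-`3` vector of the full format `3` (degree `9`) vanishes on all tensors of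
rank `≤ 4`. [this node] [cite: BurgisserIkenmeyer2011, §6.2] -/
theorem evalT_eq_zero_of_level_three_three {f : MvPolynomial (Idx 3) ℂ} (hf : f ∈ hwvSpace (rectType 3 3 3) (3 * 3))
    {t : Tensor ℂ 3} (ht : tensorRank t ≤ 4) : evalT t f = 0 :=
  evalT_eq_zero_of_emptyLevel_pred (m' := 2) (mem_emptyLevels_two_two_of_odd (by decide)) hf (r := 4)
    (by norm_num) ht

/-- The same at every ambient format `m ≥ 3` (block format `3`). [this node] -/
theorem evalT_eq_zero_of_level_three_three_corner {m : ℕ} (hm : 3 ≤ m) {F : MvPolynomial (Idx m) ℂ}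
    (hF : F ∈ hwvSpace (rectType m 3 3) (3 * 3)) {t : Tensor ℂ m} (ht : tensorRank t ≤ 4) : evalT t F = 0 :=
  evalT_eq_zero_of_emptyLevel_pred_corner (m' := 2) (mem_emptyLevels_two_two_of_odd (by decide)) hm hF (r := 4)
    (by norm_num) ht

/-- **`r₃(3) ≥ 5`:** a level-`3` vector of block format `3` that does not vanish at `t` certifies `R(t) ≥ 5`. [this node] -/
theorem five_le_tensorRank_of_level_three_three {m : ℕ} (hm : 3 ≤ m) {F : MvPolynomial (Idx m) ℂ}
    (hF : F ∈ hwvSpace (rectType m 3 3) (3 * 3)) {t : Tensor ℂ m} (ht : evalT t F ≠ 0) : 5 ≤ tensorRank t := by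
  by_contra h
  exact ht (evalT_eq_zero_of_level_three_three_corner hm hF (by omega))

/-- Level `3` of block format `3` is not a level of any point of rank `≤ 4`. [this node] -/
theorem three_not_mem_pointLevels_three {m : ℕ} (hm : 3 ≤ m) {t : Tensor ℂ m} (ht : tensorRank t ≤ 4) :
    3 ∉ pointLevels 3 t := by
  rintro ⟨F, hF, hne⟩
  exact hne (evalT_eq_zero_of_level_three_three_corner hm hF ht)

/-- Level `3` of block format `3` lies in the ideal of `GL_m³·u` for every `u` of rank `≤ 4` (`m ≥ 3`). [this node] -/
theorem hwvSpace_le_orbitVanishing_of_level_three_three {m : ℕ} (hm : 3 ≤ m) {u : Tensor ℂ m}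
    (hu : tensorRank u ≤ 4) : hwvSpace (rectType m 3 3) (3 * 3) ≤ orbitVanishing u := by
  intro F hF A B C _ _ _
  exact evalT_eq_zero_of_level_three_three_corner hm hF ((tensorRestrictsTo_actTensor A B C u).tensorRank_le.trans hu)

/-- **Level 3 of block format 3 does not pass at `m = 3, 4`:** `3 ∉ passLevels m 3` for `3 ≤ m ≤ 4`. [this node] -/
theorem three_not_mem_passLevels_three {m : ℕ} (hm : 3 ≤ m) (hm4 : m ≤ 4) : 3 ∉ passLevels m 3 := fun h =>
  h (hwvSpace_le_orbitVanishing_of_level_three_three hm ((tensorRank_unitTensor_le' m).trans hm4))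

end StrassenRange

end Summit.MatrixMultiplication.MatrixMultiplication.Theorems.ObstructionCalculus

end
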